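import Summits.AtomisticToContinuum.BoseEinsteinCondensation.Theses.BECConjugateDomination
import Summits.AtomisticToContinuum.BoseEinsteinCondensation.Theses.BECHardSphereReduction
import Summits.AtomisticToContinuum.BoseEinsteinCondensation.Theorems.BECConjugateDominationHardCoreExtensionSmoothDominant
import Literature.MathematicalPhysics.QuantumManyBody.BoseGasThermodynamicLimitRuelle
import HarnessLib

/-!
# Line `domination-order-reversal` for the crux `BECConjugateDomination.HardCoreExtension`
# (stmt-AtomisticToContinuum-11786): the composition and its residue, kernel-checked (lead c8)

The crux is `A → B`: `A` = dilute ground-state (Dirichlet) BEC for every potential of the route's SMOOTH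
CLASS (repulsive finite range, finite, `C²` as `x ↦ w(|x|)` on `ℝ³`, edge condition `‖D²w̃‖ ≤ Cₑ √w̃`),
`B` = the conjunct (the same for EVERY repulsive finite-range `v`). The line (planner card
`Cruxes/HardCoreExtension/Ideas/domination-order-reversal.md`, skeleton `Lines/domination_order_reversal.lean`)
DOMINATES instead of approximating: a comparison `w ≼ v` ("`cn w ≤ cn v + εN` eventually in `N`, for every
`ε > 0`, at every density below a threshold chosen AFTER the pair") transfers dilute BEC from `w` to `v`
(`diluteBEC_of_condensateBelow`), so `A` is invoked ONCE, at one smooth comparison potential.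

This file lands, sorry-free and with every hypothesis explicit and in tree vocabulary:

* the glue of the line (`diluteBEC_of_condensateBelow`, `condensateBelow_trans`, `le_hardSphere_of_range`);
* `hardCoreExtension_of_dominationResidue` — **the skeleton's composition with stub 2 DISCHARGED** by the
  landed `stub_smoothDominant` (p133478): registered stubs 1 (`stub_dominationOrderReversal`), 3
  (`stub_hardCoreDomination`), 4 (`stub_hardSphereStandIn`) ⊢ `HardCoreExtension` BY NAME;
* `stub_hardCoreDomination_of_hardCoreDominates` — **stub 3 is implied by the rank-2 crux
  `BECHardSphereReduction.HardCoreDominates` (stmt-11884)** of the open route `BECHardSphereReduction`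
  (guard `N a³ ≤ η₀ L_N³ ⇔ ρ a³ ≤ η₀`; the slack is not even used);
* `hardCoreExtension_of_hardCoreDominates_standIn` — **the RESHAPE the card's "honest redundancy note"
  allows, made a theorem**: `HardCoreDominates` (11884) covers the bounded half too (every admissible `v`
  lies below the hard sphere of radius range`+1`), so `HardCoreDominates ∧ stub 4 ⊢ HardCoreExtension`
  with `A` used once, at the stand-in — stubs 1–2 are then not needed;
* `hardSphereBEC_of_standIn` — stub 4 with `A` gives `BECHardSphereReduction.HardSphereBEC` (stmt-11885):
  the whole `A`-content of the line sits in the stand-in;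
* `hardCoreExtension_of_hardSphereReduction` — with `A` IDLE the crux is downstream of route
  `BECHardSphereReduction`: `HardCoreDominates → HardSphereBEC → HardCoreExtension` (its gate-written
  deciding theorem `closes` proves the conjunct);
* `diluteBEC_bounded_of_orderReversal` — the bounded half from `A` verbatim (stub 1 + landed stub 2):
  the card's first deliverable `HardCoreExtensionBounded`.

So the line's residue is {stub 1, stub 3, stub 4} as filed, or {stmt-11884, stub 4} reshaped, or
{stmt-11884, stmt-11885} with `A` idle — every member open-problem calibre (no comparison theorem for
`λ_max(γ_Ψ₀)` in the potential is in print; 11885 is LSSY's open problem in the model case).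

All `[folklore]` bookkeeping; no Theses statement is asserted unconditionally.
-/

noncomputable section

namespace Summit.AtomisticToContinuum.BoseEinsteinCondensation.Cruxes.HardCoreExtension.DominationOrderReversal

open Literature.MathematicalPhysics.QuantumManyBody.BoseGas
open _root_.Filter _root_.MeasureTheory
open scoped ENNReal NNReal Topology
open Summit.AtomisticToContinuum.BoseEinsteinCondensation.Theses

/-! ## Glue of the order `≼` (unfolded: no definitions are introduced in a proof file) -/

/-- **The one use of the antecedent, abstractly.** If `cn w ≤ cn v + εN` eventually in `N` for every
`ε > 0` at every density below `ρ₁`, and `w` has dilute BEC (`ρ₀(w)`, `c(w, ρ)`), then `v` has dilute BEC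
with `ρ₀' = min ρ₀ ρ₁` and `c' = c/2`: eventually `cN ≤ cn w ≤ cn v + (c/2)N`. [folklore] -/
theorem diluteBEC_of_condensateBelow {w v : ℝ → ℝ≥0∞}
    (hwv : ∃ ρ₁ : ℝ, 0 < ρ₁ ∧ ∀ ρ : ℝ, 0 < ρ → ρ < ρ₁ → ∀ ε : ℝ, 0 < ε →
      ∀ᶠ N : ℕ in atTop,
        condensateNumber w N (sideLength ρ N) ≤
          condensateNumber v N (sideLength ρ N) + ENNReal.ofReal (ε * N))
    (hw : ∃ ρ₀ : ℝ, 0 < ρ₀ ∧ ∀ ρ : ℝ, 0 < ρ → ρ < ρ₀ → HasGroundStateBEC w ρ) :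
    ∃ ρ₀ : ℝ, 0 < ρ₀ ∧ ∀ ρ : ℝ, 0 < ρ → ρ < ρ₀ → HasGroundStateBEC v ρ := by
  obtain ⟨ρ₁, hρ₁, hcmp⟩ := hwv
  obtain ⟨ρ₀, hρ₀, hbec⟩ := hw
  refine ⟨min ρ₀ ρ₁, lt_min hρ₀ hρ₁, fun ρ hρ hlt => ?_⟩
  obtain ⟨c, hc, hev⟩ := hbec ρ hρ (hlt.trans_le (min_le_left _ _))
  have hc2 : 0 < c / 2 := half_pos hc
  refine ⟨c / 2, hc2, ?_⟩
  filter_upwards [hev, hcmp ρ hρ (hlt.trans_le (min_le_right _ _)) (c / 2) hc2] with N hN hN'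
  have hnn : 0 ≤ c / 2 * (N : ℝ) := mul_nonneg hc2.le N.cast_nonneg
  have hsplit : ENNReal.ofReal (c * N) = ENNReal.ofReal (c / 2 * N) + ENNReal.ofReal (c / 2 * N) := by
    rw [← ENNReal.ofReal_add hnn hnn, show c / 2 * (N : ℝ) + c / 2 * (N : ℝ) = c * N by ring]
  have h := hN.trans hN'
  rw [hsplit] at h
  exact (ENNReal.add_le_add_iff_right ENNReal.ofReal_ne_top).1 h

/-- `≼` is transitive (`ρ₁ = min`, `ε/2 + ε/2`). [folklore] -/
theorem condensateBelow_trans {w u v : ℝ → ℝ≥0∞}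
    (h₁ : ∃ ρ₁ : ℝ, 0 < ρ₁ ∧ ∀ ρ : ℝ, 0 < ρ → ρ < ρ₁ → ∀ ε : ℝ, 0 < ε →
      ∀ᶠ N : ℕ in atTop,
        condensateNumber w N (sideLength ρ N) ≤
          condensateNumber u N (sideLength ρ N) + ENNReal.ofReal (ε * N))
    (h₂ : ∃ ρ₁ : ℝ, 0 < ρ₁ ∧ ∀ ρ : ℝ, 0 < ρ → ρ < ρ₁ → ∀ ε : ℝ, 0 < ε →
      ∀ᶠ N : ℕ in atTop,
        condensateNumber u N (sideLength ρ N) ≤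
          condensateNumber v N (sideLength ρ N) + ENNReal.ofReal (ε * N)) :
    ∃ ρ₁ : ℝ, 0 < ρ₁ ∧ ∀ ρ : ℝ, 0 < ρ → ρ < ρ₁ → ∀ ε : ℝ, 0 < ε →
      ∀ᶠ N : ℕ in atTop,
        condensateNumber w N (sideLength ρ N) ≤
          condensateNumber v N (sideLength ρ N) + ENNReal.ofReal (ε * N) := by
  obtain ⟨ρ₁, hρ₁, H₁⟩ := h₁
  obtain ⟨ρ₂, hρ₂, H₂⟩ := h₂
  refine ⟨min ρ₁ ρ₂, lt_min hρ₁ hρ₂, fun ρ hρ hlt ε hε => ?_⟩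
  have hε2 : 0 < ε / 2 := half_pos hε
  filter_upwards [H₁ ρ hρ (hlt.trans_le (min_le_left _ _)) (ε / 2) hε2,
    H₂ ρ hρ (hlt.trans_le (min_le_right _ _)) (ε / 2) hε2] with N hN₁ hN₂
  have hnn : 0 ≤ ε / 2 * (N : ℝ) := mul_nonneg hε2.le N.cast_nonneg
  calc condensateNumber w N (sideLength ρ N)
      ≤ condensateNumber u N (sideLength ρ N) + ENNReal.ofReal (ε / 2 * N) := hN₁
    _ ≤ condensateNumber v N (sideLength ρ N) + ENNReal.ofReal (ε / 2 * N) +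
          ENNReal.ofReal (ε / 2 * N) := add_le_add hN₂ le_rfl
    _ = condensateNumber v N (sideLength ρ N) + ENNReal.ofReal (ε * N) := by
        rw [add_assoc, ← ENNReal.ofReal_add hnn hnn,
          show ε / 2 * (N : ℝ) + ε / 2 * (N : ℝ) = ε * N by ring]

/-- Every profile vanishing beyond `R` lies below the hard sphere `⊤·1_{(-∞, a]}` of any radius `a > R`
on `[0, ∞)` (indeed everywhere). [cite: LSSY2005, Ch. 2 after (2.1)] -/
theorem le_hardSphere_of_range {v : ℝ → ℝ≥0∞} {R a : ℝ} (hvR : ∀ r, R < r → v r = 0)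
    (hRa : R < a) : ∀ r, 0 ≤ r → v r ≤ Set.indicator (Set.Iic a) (fun _ => (⊤ : ℝ≥0∞)) r := by
  intro r _
  by_cases h : r ≤ a
  · simp [Set.indicator_of_mem (Set.mem_Iic.2 h)]
  · rw [hvR r (hRa.trans (lt_of_not_ge h))]
    exact zero_le

/-- **An exact fixed-box domination under a dilute guard gives `≼` along the thermodynamic sequence**
(no slack needed): if `cn u N L ≤ cn v N L` whenever `N a³ ≤ η₀ L³`, then along `L_N = (N/ρ)^{1/3}`
the guard reads `ρ a³ ≤ η₀`, so `u ≼ v` with `ρ₁ := η₀ / a³`. [folklore] -/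
theorem condensateBelow_of_boxDomination {u v : ℝ → ℝ≥0∞} {a η₀ : ℝ} (ha : 0 < a) (hη₀ : 0 < η₀)
    (hdom : ∀ (N : ℕ) (L : ℝ), (N : ℝ) * a ^ 3 ≤ η₀ * L ^ 3 →
      condensateNumber u N L ≤ condensateNumber v N L) :
    ∃ ρ₁ : ℝ, 0 < ρ₁ ∧ ∀ ρ : ℝ, 0 < ρ → ρ < ρ₁ → ∀ ε : ℝ, 0 < ε →
      ∀ᶠ N : ℕ in atTop,
        condensateNumber u N (sideLength ρ N) ≤
          condensateNumber v N (sideLength ρ N) + ENNReal.ofReal (ε * N) := by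
  have ha3 : 0 < a ^ 3 := pow_pos ha 3
  refine ⟨η₀ / a ^ 3, div_pos hη₀ ha3, fun ρ hρ hlt ε _ => Eventually.of_forall fun N => ?_⟩
  have hρa : ρ * a ^ 3 ≤ η₀ := ((lt_div_iff₀ ha3).1 hlt).le
  refine (hdom N (sideLength ρ N) ?_).trans le_self_add
  rw [sideLength_pow_three hρ N]
  have hNρ : 0 ≤ (N : ℝ) / ρ := div_nonneg N.cast_nonneg hρ.le
  calc (N : ℝ) * a ^ 3 = (N : ℝ) / ρ * (ρ * a ^ 3) := by field_simp
    _ ≤ (N : ℝ) / ρ * η₀ := mul_le_mul_of_nonneg_left hρa hNρ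
    _ = η₀ * ((N : ℝ) / ρ) := by ring

/-! ## Stub 3 is implied by stmt-11884; stub 4 carries the `A`-content (⇒ stmt-11885) -/

/-- **Registered stub 3 `stub_hardCoreDomination` follows from the rank-2 crux `HardCoreDominates` of route
`BECHardSphereReduction` (stmt-AtomisticToContinuum-11884)** — verbatim the registered signature as
conclusion; roughness and the slack are not even used. [folklore] -/
theorem stub_hardCoreDomination_of_hardCoreDominates (h : BECHardSphereReduction.HardCoreDominates) :
    ∀ a : ℝ, 0 < a → ∀ v : ℝ → ℝ≥0∞, IsRepulsiveFiniteRange v →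
      (∀ M : ℝ≥0, ∃ r, 0 ≤ r ∧ (M : ℝ≥0∞) < v r) →
      (∀ r, 0 ≤ r → v r ≤ Set.indicator (Set.Iic a) (fun _ => (⊤ : ℝ≥0∞)) r) →
      ∃ ρ₁ : ℝ, 0 < ρ₁ ∧ ∀ ρ : ℝ, 0 < ρ → ρ < ρ₁ → ∀ ε : ℝ, 0 < ε →
        ∀ᶠ N : ℕ in atTop,
          condensateNumber (Set.indicator (Set.Iic a) (fun _ => (⊤ : ℝ≥0∞))) N (sideLength ρ N) ≤
            condensateNumber v N (sideLength ρ N) + ENNReal.ofReal (ε * N) := by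
  intro a ha v hv _ hle
  have hva : ∀ r : ℝ, a < r → v r = 0 := fun r hr => by
    have h0 := hle r (ha.le.trans hr.le)
    rw [Set.indicator_of_notMem (show r ∉ Set.Iic a from fun hm => (not_le.2 hr) hm)] at h0
    exact le_antisymm h0 zero_le
  obtain ⟨η₀, hη₀, hdom⟩ := h v a hv.1 ha hva
  exact condensateBelow_of_boxDomination ha hη₀ hdom

/-- **Registered stub 4 with the antecedent `A` gives dilute hard-sphere BEC, i.e. the rank-3 crux
`HardSphereBEC` of route `BECHardSphereReduction` (stmt-AtomisticToContinuum-11885)**: the whole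
`A`-content of the line sits in the stand-in (`A` once, at the stand-in `w`, then `w ≼ HS_a`). [folklore] -/
theorem hardSphereBEC_of_standIn
    (h₄ : ∀ a : ℝ, 0 < a → ∃ w : ℝ → ℝ≥0∞,
      (IsRepulsiveFiniteRange w ∧ (∀ r, w r ≠ ⊤) ∧ ContDiff ℝ 2 (fun x : Space => (w ‖x‖).toReal) ∧
        ∃ Cₑ : ℝ, ∀ x : Space,
          ‖iteratedFDeriv ℝ 2 (fun x : Space => (w ‖x‖).toReal) x‖ ≤ Cₑ * Real.sqrt ((w ‖x‖).toReal)) ∧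
      ∃ ρ₁ : ℝ, 0 < ρ₁ ∧ ∀ ρ : ℝ, 0 < ρ → ρ < ρ₁ → ∀ ε : ℝ, 0 < ε →
        ∀ᶠ N : ℕ in atTop,
          condensateNumber w N (sideLength ρ N) ≤
            condensateNumber (Set.indicator (Set.Iic a) (fun _ => (⊤ : ℝ≥0∞))) N (sideLength ρ N) +
              ENNReal.ofReal (ε * N))
    (hA : ∀ v : ℝ → ℝ≥0∞, IsRepulsiveFiniteRange v → (∀ r, v r ≠ ⊤) →
      ContDiff ℝ 2 (fun x : Space => (v ‖x‖).toReal) →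
      (∃ Cₑ : ℝ, ∀ x : Space, ‖iteratedFDeriv ℝ 2 (fun x : Space => (v ‖x‖).toReal) x‖ ≤
          Cₑ * Real.sqrt ((v ‖x‖).toReal)) →
      ∃ ρ₀ : ℝ, 0 < ρ₀ ∧ ∀ ρ : ℝ, 0 < ρ → ρ < ρ₀ → HasGroundStateBEC v ρ) :
    BECHardSphereReduction.HardSphereBEC := by
  intro a ha
  obtain ⟨w, ⟨hw1, hw2, hw3, hw4⟩, hcmp⟩ := h₄ a ha
  exact diluteBEC_of_condensateBelow hcmp (hA w hw1 hw2 hw3 hw4)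

/-! ## The bounded half from `A` verbatim (the card's first deliverable `HardCoreExtensionBounded`) -/

/-- **The bounded half of the crux from stub 1 and the antecedent alone** (stub 2 landed): every
admissible profile bounded on `[0, ∞)` — steps, finite shells, kinks, `C²` profiles violating the edge
condition, non-lsc profiles `V₀·1_K` — has dilute BEC, `A` being used ONCE, at its smooth dominant. [folklore] -/
theorem diluteBEC_bounded_of_orderReversal
    (h₁ : ∀ v w : ℝ → ℝ≥0∞, IsRepulsiveFiniteRange v →
      (IsRepulsiveFiniteRange w ∧ (∀ r, w r ≠ ⊤) ∧ ContDiff ℝ 2 (fun x : Space => (w ‖x‖).toReal) ∧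
        ∃ Cₑ : ℝ, ∀ x : Space,
          ‖iteratedFDeriv ℝ 2 (fun x : Space => (w ‖x‖).toReal) x‖ ≤ Cₑ * Real.sqrt ((w ‖x‖).toReal)) →
      (∀ r, 0 ≤ r → v r ≤ w r) →
      ∃ ρ₁ : ℝ, 0 < ρ₁ ∧ ∀ ρ : ℝ, 0 < ρ → ρ < ρ₁ → ∀ ε : ℝ, 0 < ε →
        ∀ᶠ N : ℕ in atTop,
          condensateNumber w N (sideLength ρ N) ≤
            condensateNumber v N (sideLength ρ N) + ENNReal.ofReal (ε * N))
    (hA : ∀ v : ℝ → ℝ≥0∞, IsRepulsiveFiniteRange v → (∀ r, v r ≠ ⊤) →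
      ContDiff ℝ 2 (fun x : Space => (v ‖x‖).toReal) →
      (∃ Cₑ : ℝ, ∀ x : Space, ‖iteratedFDeriv ℝ 2 (fun x : Space => (v ‖x‖).toReal) x‖ ≤
          Cₑ * Real.sqrt ((v ‖x‖).toReal)) →
      ∃ ρ₀ : ℝ, 0 < ρ₀ ∧ ∀ ρ : ℝ, 0 < ρ → ρ < ρ₀ → HasGroundStateBEC v ρ)
    {v : ℝ → ℝ≥0∞} (hv : IsRepulsiveFiniteRange v) (hb : ∃ M : ℝ≥0, ∀ r, 0 ≤ r → v r ≤ M) :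
    ∃ ρ₀ : ℝ, 0 < ρ₀ ∧ ∀ ρ : ℝ, 0 < ρ → ρ < ρ₀ → HasGroundStateBEC v ρ := by
  obtain ⟨w, ⟨hw1, hw2, hw3, hw4⟩, hvw⟩ := stub_smoothDominant v hv hb
  exact diluteBEC_of_condensateBelow (h₁ v w hv ⟨hw1, hw2, hw3, hw4⟩ hvw) (hA w hw1 hw2 hw3 hw4)

/-! ## The composition of the line (stub 2 discharged by the landed `stub_smoothDominant`) -/

/-- **`HardCoreExtension` from the line's residue {stub 1, stub 3, stub 4}** — the skeleton's composition
`HardCoreExtension_of` with the registered stubs 1, 3, 4 as explicit hypotheses (verbatim their registered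
signatures) and stub 2 `stub_smoothDominant` DISCHARGED (landed p133478, imported): split on whether `v` is
bounded on `[0, ∞)`; bounded → smooth dominant `w ≥ v` (stub 2) and `w ≼ v` (stub 1), `A` once at `w`;
rough → `HS_a ≼ v` for `a =` range`+1` (stub 3) and a smooth stand-in `w ≼ HS_a` (stub 4), transitivity,
`A` once at `w`. [folklore] -/
theorem hardCoreExtension_of_dominationResidue :
    (∀ v w : ℝ → ℝ≥0∞, IsRepulsiveFiniteRange v →
      (IsRepulsiveFiniteRange w ∧ (∀ r, w r ≠ ⊤) ∧ ContDiff ℝ 2 (fun x : Space => (w ‖x‖).toReal) ∧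
        ∃ Cₑ : ℝ, ∀ x : Space,
          ‖iteratedFDeriv ℝ 2 (fun x : Space => (w ‖x‖).toReal) x‖ ≤ Cₑ * Real.sqrt ((w ‖x‖).toReal)) →
      (∀ r, 0 ≤ r → v r ≤ w r) →
      ∃ ρ₁ : ℝ, 0 < ρ₁ ∧ ∀ ρ : ℝ, 0 < ρ → ρ < ρ₁ → ∀ ε : ℝ, 0 < ε →
        ∀ᶠ N : ℕ in atTop,
          condensateNumber w N (sideLength ρ N) ≤
            condensateNumber v N (sideLength ρ N) + ENNReal.ofReal (ε * N)) →
    (∀ a : ℝ, 0 < a → ∀ v : ℝ → ℝ≥0∞, IsRepulsiveFiniteRange v →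
      (∀ M : ℝ≥0, ∃ r, 0 ≤ r ∧ (M : ℝ≥0∞) < v r) →
      (∀ r, 0 ≤ r → v r ≤ Set.indicator (Set.Iic a) (fun _ => (⊤ : ℝ≥0∞)) r) →
      ∃ ρ₁ : ℝ, 0 < ρ₁ ∧ ∀ ρ : ℝ, 0 < ρ → ρ < ρ₁ → ∀ ε : ℝ, 0 < ε →
        ∀ᶠ N : ℕ in atTop,
          condensateNumber (Set.indicator (Set.Iic a) (fun _ => (⊤ : ℝ≥0∞))) N (sideLength ρ N) ≤
            condensateNumber v N (sideLength ρ N) + ENNReal.ofReal (ε * N)) →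
    (∀ a : ℝ, 0 < a → ∃ w : ℝ → ℝ≥0∞,
      (IsRepulsiveFiniteRange w ∧ (∀ r, w r ≠ ⊤) ∧ ContDiff ℝ 2 (fun x : Space => (w ‖x‖).toReal) ∧
        ∃ Cₑ : ℝ, ∀ x : Space,
          ‖iteratedFDeriv ℝ 2 (fun x : Space => (w ‖x‖).toReal) x‖ ≤ Cₑ * Real.sqrt ((w ‖x‖).toReal)) ∧
      ∃ ρ₁ : ℝ, 0 < ρ₁ ∧ ∀ ρ : ℝ, 0 < ρ → ρ < ρ₁ → ∀ ε : ℝ, 0 < ε →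
        ∀ᶠ N : ℕ in atTop,
          condensateNumber w N (sideLength ρ N) ≤
            condensateNumber (Set.indicator (Set.Iic a) (fun _ => (⊤ : ℝ≥0∞))) N (sideLength ρ N) +
              ENNReal.ofReal (ε * N)) →
    BECConjugateDomination.HardCoreExtension := by
  intro h₁ h₃ h₄ hA v hv
  by_cases hb : ∃ M : ℝ≥0, ∀ r, 0 ≤ r → v r ≤ M
  · -- bounded half: smooth dominant (landed stub 2) + order reversal (stub 1), `A` once at `w`
    exact diluteBEC_bounded_of_orderReversal h₁ hA hv hb
  · -- rough half: hard-sphere pivot (stub 3) + smooth stand-in (stub 4), `A` once at the stand-in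
    have hr : ∀ M : ℝ≥0, ∃ r, 0 ≤ r ∧ (M : ℝ≥0∞) < v r := by
      intro M
      by_contra hM
      push Not at hM
      exact hb ⟨M, fun r hr0 => hM r hr0⟩
    obtain ⟨R, hR, hvR⟩ := hv.exists_pos_range
    have ha : 0 < R + 1 := by linarith
    obtain ⟨w, ⟨hw1, hw2, hw3, hw4⟩, hwHS⟩ := h₄ (R + 1) ha
    have hHSv := h₃ (R + 1) ha v hv hr (le_hardSphere_of_range hvR (by linarith))
    exact diluteBEC_of_condensateBelow (condensateBelow_trans hwHS hHSv) (hA w hw1 hw2 hw3 hw4)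

/-! ## The reshape: `HardCoreDominates` (stmt-11884) ∧ stub 4 suffice (`A` once; stubs 1–2 not needed) -/

/-- **`HardCoreExtension` from `BECHardSphereReduction.HardCoreDominates` (stmt-11884) and the registered
stand-in stub 4 alone** (the card's "honest redundancy note" as a theorem): EVERY admissible `v` (bounded or
rough) of range `R₀` lies below the hard sphere of radius `a := max R₀ 0 + 1`, the exact fixed-box
domination `cn HS_a ≤ cn v` under `N a³ ≤ η₀ L³` gives `HS_a ≼ v`, a smooth stand-in `w ≼ HS_a` exists
(stub 4), and `A` at `w` transfers down the chain `w ≼ HS_a ≼ v`. [folklore] -/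
theorem hardCoreExtension_of_hardCoreDominates_standIn (hD : BECHardSphereReduction.HardCoreDominates)
    (h₄ : ∀ a : ℝ, 0 < a → ∃ w : ℝ → ℝ≥0∞,
      (IsRepulsiveFiniteRange w ∧ (∀ r, w r ≠ ⊤) ∧ ContDiff ℝ 2 (fun x : Space => (w ‖x‖).toReal) ∧
        ∃ Cₑ : ℝ, ∀ x : Space,
          ‖iteratedFDeriv ℝ 2 (fun x : Space => (w ‖x‖).toReal) x‖ ≤ Cₑ * Real.sqrt ((w ‖x‖).toReal)) ∧
      ∃ ρ₁ : ℝ, 0 < ρ₁ ∧ ∀ ρ : ℝ, 0 < ρ → ρ < ρ₁ → ∀ ε : ℝ, 0 < ε →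
        ∀ᶠ N : ℕ in atTop,
          condensateNumber w N (sideLength ρ N) ≤
            condensateNumber (Set.indicator (Set.Iic a) (fun _ => (⊤ : ℝ≥0∞))) N (sideLength ρ N) +
              ENNReal.ofReal (ε * N)) :
    BECConjugateDomination.HardCoreExtension := by
  intro hA v hv
  obtain ⟨R, hR, hvR⟩ := hv.exists_pos_range
  have ha : 0 < R + 1 := by linarith
  have hva : ∀ r : ℝ, R + 1 < r → v r = 0 := fun r hr => hvR r (by linarith)
  obtain ⟨η₀, hη₀, hdom⟩ := hD v (R + 1) hv.1 ha hva
  obtain ⟨w, ⟨hw1, hw2, hw3, hw4⟩, hwHS⟩ := h₄ (R + 1) ha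
  exact diluteBEC_of_condensateBelow
    (condensateBelow_trans hwHS (condensateBelow_of_boxDomination ha hη₀ hdom)) (hA w hw1 hw2 hw3 hw4)

/-- **With `A` idle the crux is downstream of route `BECHardSphereReduction`**: its two cruxes
`HardCoreDominates` (stmt-11884) and `HardSphereBEC` (stmt-11885) prove the conjunct (the gate-written
deciding theorem `BECHardSphereReduction.closes`), hence the implication `HardCoreExtension`. [folklore] -/
theorem hardCoreExtension_of_hardSphereReduction (hD : BECHardSphereReduction.HardCoreDominates)
    (hB : BECHardSphereReduction.HardSphereBEC) : BECConjugateDomination.HardCoreExtension :=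
  fun _ => BECHardSphereReduction.closes hD hB

/-- **The skeleton as filed with stub 3 supplied by stmt-11884**: stub 1 ∧ `HardCoreDominates` ∧ stub 4 ⊢
`HardCoreExtension` (weaker than `hardCoreExtension_of_hardCoreDominates_standIn`, which drops stub 1; recorded
to pin the implication "11884 ⇒ stub 3" inside the composition). [folklore] -/
theorem hardCoreExtension_of_orderReversal_hardCoreDominates_standIn
    (h₁ : ∀ v w : ℝ → ℝ≥0∞, IsRepulsiveFiniteRange v →
      (IsRepulsiveFiniteRange w ∧ (∀ r, w r ≠ ⊤) ∧ ContDiff ℝ 2 (fun x : Space => (w ‖x‖).toReal) ∧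
        ∃ Cₑ : ℝ, ∀ x : Space,
          ‖iteratedFDeriv ℝ 2 (fun x : Space => (w ‖x‖).toReal) x‖ ≤ Cₑ * Real.sqrt ((w ‖x‖).toReal)) →
      (∀ r, 0 ≤ r → v r ≤ w r) →
      ∃ ρ₁ : ℝ, 0 < ρ₁ ∧ ∀ ρ : ℝ, 0 < ρ → ρ < ρ₁ → ∀ ε : ℝ, 0 < ε →
        ∀ᶠ N : ℕ in atTop,
          condensateNumber w N (sideLength ρ N) ≤
            condensateNumber v N (sideLength ρ N) + ENNReal.ofReal (ε * N))
    (hD : BECHardSphereReduction.HardCoreDominates)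
    (h₄ : ∀ a : ℝ, 0 < a → ∃ w : ℝ → ℝ≥0∞,
      (IsRepulsiveFiniteRange w ∧ (∀ r, w r ≠ ⊤) ∧ ContDiff ℝ 2 (fun x : Space => (w ‖x‖).toReal) ∧
        ∃ Cₑ : ℝ, ∀ x : Space,
          ‖iteratedFDeriv ℝ 2 (fun x : Space => (w ‖x‖).toReal) x‖ ≤ Cₑ * Real.sqrt ((w ‖x‖).toReal)) ∧
      ∃ ρ₁ : ℝ, 0 < ρ₁ ∧ ∀ ρ : ℝ, 0 < ρ → ρ < ρ₁ → ∀ ε : ℝ, 0 < ε →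
        ∀ᶠ N : ℕ in atTop,
          condensateNumber w N (sideLength ρ N) ≤
            condensateNumber (Set.indicator (Set.Iic a) (fun _ => (⊤ : ℝ≥0∞))) N (sideLength ρ N) +
              ENNReal.ofReal (ε * N)) :
    BECConjugateDomination.HardCoreExtension :=
  hardCoreExtension_of_dominationResidue h₁ (stub_hardCoreDomination_of_hardCoreDominates hD) h₄

end Summit.AtomisticToContinuum.BoseEinsteinCondensation.Cruxes.HardCoreExtension.DominationOrderReversal

end
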